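import Summits.ValiantsHypothesis.ValiantsHypothesis.Theses.LangWeilTransfer
import Summits.ValiantsHypothesis.ValiantsHypothesis.Theorems.LangWeilTransferShatteringExclusionFewBranchesDescent

/-!
# Birth skeleton v2 — crux `ShatteringExclusion` (item `stmt-ValiantsHypothesis-6372`), line `birth`

Route `route-ValiantsHypothesis-LangWeilTransfer`, crux
`Summit.ValiantsHypothesis.ValiantsHypothesis.Theses.LangWeilTransfer.ShatteringExclusion` (SE):
for every `c` there are `c', d₀, N` such that for `n ≥ N`, if `per_n` has a fan-in-two `ℂ`-circuit of
size `≤ n^c` then it has one of size `≤ n^c'` whose COEFFICIENT IDEAL `I ⊂ ℚ[Y_0 … Y_{4s}]`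
(the `x`-coefficients of Bürgisser's integer skeleton minus those of `per_n`) has a minimal prime `𝔭`
with `0 < #minprimes(𝔭·ℚ̄[Y]) ≤ n^d₀` (a geometric component with at most `n^d₀` Galois conjugates).
NB: `I` depends on the circuit only through its SHAPE (which operands are constants, the wiring);
the constants enter only through non-emptiness of the constants variety `V(I) ∋ slotConst P`.

LINE (point certificate for a tame component), v2.  A `K`-point `y` of `V(I)` (`[K:ℚ] ≤ B`) lying
on at most `B'` geometric components certifies a component with at most `B · B'` Galois conjugates:
`Gal(ℚ̄/ℚ(y))` permutes the components through the fixed point `y`, so the stabiliser of any one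
of them has index `≤ B'` in `Gal(ℚ̄/ℚ(y))`, which has index `[ℚ(y):ℚ] ≤ B` in `Gal(ℚ̄/ℚ)`.
v1 (2026-08-17) asked for EXACTLY ONE component through `y` (`stub_unibranching`, `B' = 1`); v2
(2026-08-28, director-valiant ruling 2026-08-27T22:39Z on the prover census
`Cruxes/ShatteringExclusion/BirthStubsCensusP1.md`) registers the weakest point certificate the
descent can use — POLYNOMIALLY MANY components through `y` — and proves its descent:

* `stub_lowDegreeConstants` (LowDegreeConstants — CONSTANT DESCENT FOR THE PERMANENT, open-problem
  grade; registered signature byte-identical to v1) — near-optimal `ℂ`-circuits for `per_n` can be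
  re-chosen, at polynomial cost, with ALL constants in a number field `K ⊆ ℂ` of degree `≤ n^d₀`.
  CALIBRATED (val-width-6372-p1 g0): it is EQUIVALENT to `RationalDescent` (poly-size ℚ-circuits for
  `per_n` from poly-size ℂ-circuits; `Theorems/…ShatteringExclusionRationalDescent.lean`,
  `lowDegreeConstants_iff_rationalDescent`) and TRUE without its degree bound
  (`…AlgebraicConstants.lean`, `lowDegreeConstants_without_degree_bound`): the nonuniform,
  permanent-specific form of "VP_ℂ = VNP_ℂ ⇒ VP_ℚ = VNP_ℚ" (Bürgisser 2000 Ch. 4; GRH-free transfer open).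
* `stub_fewBranches` (FewBranches — the structural bet, conjecture grade; REPLACES v1
  `stub_unibranching`) — a near-optimal circuit for `per_n` with constants in a degree-`n^O(1)` field
  can be rewired (polynomial cost, possibly a larger degree-`n^O(1)` field) so that its constant
  vector `y = slotConst` lies on at most `n^{d₁}` irreducible components of the complexified
  constants variety `V_ℂ(I)` (typed: the set of minimal primes of `I·ℂ[Y]` below `ker (ev_y)` has
  `0 < ncard ≤ n^{d₁}`; positivity is automatic for a circuit computing `per_n`,
  `…UnibranchLocal.map_circuitCoeffIdeal_le_ker`).  `Unibranching → FewBranches`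
  (`fewBranches_of_unibranching`, `d₁ = 0`), so every sufficient condition recorded for v1 (smooth
  point; primality of the local radical `√(I·ℂ[Y]_{𝔪_y})`,
  `…UnibranchLocal.unibranching_of_locallyIrreducibleRewiring`; the slot-unfolding criterion (a) of
  the census: `Φ_P⁻¹(per_n + L)` locally irreducible at `slotConst P` for a poly-dimensional space `L`
  of cheaply computable polynomials) remains sufficient.  Why it might fail: in a Galois-dark world
  every low-degree point of every near-optimal constants variety is a crossing of superpolynomially
  many conjugate components (contrapositive of the descent: a component with `n^ω(1)` conjugates
  carries only such low-degree points).
* `stub_fewBranchesDescent` (FewBranchesDescent — GALOIS DESCENT FROM A POINT WITH FEW BRANCHES, a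
  theorem, LANDED p588469; REPLACES v1 `stub_componentDescent` = the case `B' = 1`, p572771) — for ANY ideal
  `I ⊆ ℚ[Y_1..Y_m]`, any `y ∈ K^m` (`[K:ℚ] ≤ B`) with `0 < #branches(y) ≤ B'`: some minimal prime
  `𝔭 ⊇ I` has `0 < #minprimes(𝔭·ℚ̄[Y]) ≤ B · B'`.  PROVED:
  `Theorems/LangWeilTransferShatteringExclusionFewBranchesDescent.lean`
  (`…Theorems.LangWeilTransfer.ShatteringExclusion.stub_fewBranchesDescent`, on
  `Literature.RingTheory.MvPolynomial.GeomComponentsFewBranches`).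
* `ShatteringExclusion_of : Registered.stub_lowDegreeConstants → Registered.stub_fewBranches →
  ShatteringExclusion` — the composition, sorry-free (the landed descent stub is used BY NAME inside;
  pure logic otherwise: thresholds `N = max N₁ N₂`, exponents `d₀ = d₂ + d₃` by `pow_add`); the final
  `example : ShatteringExclusion` wires the two open stubs into it.

Certificates considered and NOT registered (census): "`V_ℂ(I)` has `≤ n^d` components in total"
(no number field needed!) is killed by wiring symmetries — an identifiable `ΣΠΣ` shape of type
`(r, d)` already has `r!·(d!)^r` components (torus-orbit closures of the permuted decompositions);
"unique component OF A GIVEN DIMENSION through `y`" (descent landed in Literature generality,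
`GeomComponentsInvariantLabel`) is incomparable with FewBranches and needs a Krull-dimension
base-change `ℚ̄ ↔ ℂ` not in the tree; the labelled few-branches descent
(`GeomComponentsFewBranches.…_of_invariant`) covers both once that transfer exists.

Disproof used: none (no `Disproof.lean` / `_false_without_` theorem / `Negative/` lemma exists for
this crux, `ledger crux ls` 2026-08-28).  Negatives index: empty for this line.  VP ≠ VNP is NOT
moved by anything in this file: SE, both open stubs and the route stay open / conditional.
-/

set_option linter.dupNamespace false

namespace Summit.ValiantsHypothesis.ValiantsHypothesis.Cruxes.ShatteringExclusion.Birth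

open Summit.ValiantsHypothesis.ValiantsHypothesis.Theses.LangWeilTransfer

/-- **LowDegreeConstants — CONSTANT DESCENT FOR THE PERMANENT** (stub statement, named): for every
`c` there are `c', d₀, N` such that for `n ≥ N`, if `per_n` has a fan-in-two `ℂ`-circuit of size
`≤ n^c`, then it has one of size `≤ n^c'` all of whose constants (`slotConst`: sum coefficients,
constant operands, output constant) lie in an intermediate field `ℚ ⊆ K ⊆ ℂ`, finite over `ℚ` of
degree `≤ n^d₀`. [open-problem grade; calibrated ⇔ RationalDescent: Burgisser2000 Ch. 4,
Burgisser2000TCS §4–5, doi:10.1006/jcom.1997.0433 (Koiran), arXiv:2406.06217 Rem. 2.26 / Thm. 4.10] -/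
def LowDegreeConstants : Prop :=
  ∀ c : ℕ, ∃ c' d₀ N : ℕ, ∀ n ≥ N,
    (∃ P : Literature.Computability.AlgebraicComplexity.ArithCircuit ℂ (Fin n × Fin n),
        P.IsFanInTwo ∧ P.size ≤ n ^ c ∧
          P.Computes (Literature.Computability.AlgebraicComplexity.perPoly (Fin n) ℂ)) →
      ∃ P : Literature.Computability.AlgebraicComplexity.ArithCircuit ℂ (Fin n × Fin n),
        P.IsFanInTwo ∧ P.size ≤ n ^ c' ∧
          P.Computes (Literature.Computability.AlgebraicComplexity.perPoly (Fin n) ℂ) ∧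
          ∃ K : IntermediateField ℚ ℂ, FiniteDimensional ℚ K ∧ Module.finrank ℚ K ≤ n ^ d₀ ∧
            ∀ v : Fin (4 * P.size + 1), Literature.Computability.AlgebraicComplexity.slotConst P v ∈ K

/-- **FewBranches — A LOW-DEGREE CONSTANT VECTOR ON POLYNOMIALLY MANY COMPONENTS** (stub statement,
named; the structural bet of the line, v2): for every `c, d₀` there are `c', d₀', d₁, N` such that
for `n ≥ N`, if `per_n` has a fan-in-two circuit of size `≤ n^c` with all constants in an
intermediate field of degree `≤ n^d₀`, then it has one of size `≤ n^c'` with all constants in an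
intermediate field `K` of degree `≤ n^d₀'` whose constant vector `y = slotConst` lies on at least one
and at most `n^{d₁}` irreducible components of the complexified constants variety: the set of minimal
primes of `I·ℂ[Y]` (`I` = the coefficient ideal of SE) contained in the point ideal `ker (ev_y)` has
`0 < ncard ≤ n^{d₁}`. [conjecture grade; why it might fail: all low-degree points of all near-optimal
constants varieties are crossings of superpolynomially many conjugate components (the Galois-dark
regime, pinned to points); sources: Burgisser2000TCS §5 (A3) (the skeleton and its constants
variety), arXiv:2606.25121, doi:10.1006/jcom.1997.0433] -/
def FewBranches : Prop :=
  ∀ c d₀ : ℕ, ∃ c' d₀' d₁ N : ℕ, ∀ n ≥ N,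
    (∃ P : Literature.Computability.AlgebraicComplexity.ArithCircuit ℂ (Fin n × Fin n),
        P.IsFanInTwo ∧ P.size ≤ n ^ c ∧
          P.Computes (Literature.Computability.AlgebraicComplexity.perPoly (Fin n) ℂ) ∧
          ∃ K : IntermediateField ℚ ℂ, FiniteDimensional ℚ K ∧ Module.finrank ℚ K ≤ n ^ d₀ ∧
            ∀ v : Fin (4 * P.size + 1),
              Literature.Computability.AlgebraicComplexity.slotConst P v ∈ K) →
      ∃ P : Literature.Computability.AlgebraicComplexity.ArithCircuit ℂ (Fin n × Fin n),
        P.IsFanInTwo ∧ P.size ≤ n ^ c' ∧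
          P.Computes (Literature.Computability.AlgebraicComplexity.perPoly (Fin n) ℂ) ∧
          ∃ K : IntermediateField ℚ ℂ, FiniteDimensional ℚ K ∧ Module.finrank ℚ K ≤ n ^ d₀' ∧
            (∀ v : Fin (4 * P.size + 1),
              Literature.Computability.AlgebraicComplexity.slotConst P v ∈ K) ∧
            ∃ I : Ideal (MvPolynomial (Fin (4 * P.size + 1)) ℚ),
              I = Ideal.span (Set.range fun α : (Fin n × Fin n) →₀ ℕ =>
                MvPolynomial.map (Int.castRingHom ℚ) (MvPolynomial.coeff α
                  (MvPolynomial.sumAlgEquiv ℤ (Fin n × Fin n) (Fin (4 * P.size + 1))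
                    (Literature.Computability.AlgebraicComplexity.skeleton P).eval) -
                  MvPolynomial.C (MvPolynomial.coeff α
                    (Literature.Computability.AlgebraicComplexity.perPoly (Fin n) ℤ)))) ∧
              0 < {𝔓 : Ideal (MvPolynomial (Fin (4 * P.size + 1)) ℂ) |
                    𝔓 ∈ (I.map (MvPolynomial.map (algebraMap ℚ ℂ))).minimalPrimes ∧
                      𝔓 ≤ RingHom.ker (MvPolynomial.aeval
                        (fun v : Fin (4 * P.size + 1) =>
                          Literature.Computability.AlgebraicComplexity.slotConst P v) :
                            MvPolynomial (Fin (4 * P.size + 1)) ℂ →ₐ[ℂ] ℂ)}.ncard ∧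
              {𝔓 : Ideal (MvPolynomial (Fin (4 * P.size + 1)) ℂ) |
                  𝔓 ∈ (I.map (MvPolynomial.map (algebraMap ℚ ℂ))).minimalPrimes ∧
                    𝔓 ≤ RingHom.ker (MvPolynomial.aeval
                      (fun v : Fin (4 * P.size + 1) =>
                        Literature.Computability.AlgebraicComplexity.slotConst P v) :
                          MvPolynomial (Fin (4 * P.size + 1)) ℂ →ₐ[ℂ] ℂ)}.ncard ≤ n ^ d₁

/-- **FewBranchesDescent — GALOIS DESCENT FROM A POINT WITH FEW BRANCHES** (stub statement, named; a
theorem of commutative algebra / Galois theory): for an ideal `I ⊆ ℚ[Y_1..Y_m]`, an intermediate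
field `ℚ ⊆ K ⊆ ℂ` of finite degree `≤ B` and a point `y ∈ K^m` such that the set of minimal primes of
`I·ℂ[Y]` below `ker (ev_y)` (the irreducible components of `V_ℂ(I)` through `y`) is nonempty of size
`≤ B'`, some minimal prime `𝔭` of `I` has `0 < #minprimes(𝔭·ℚ̄[Y]) ≤ B · B'`: the `ℚ`-closure of a
component `W` through `y` is `V(𝔭)`, its geometric components form the Galois orbit of `W`, and
`g ↦ gW` factors through `(g|_{ℚ(y)}, hW)` with `h ∈ Stab(y)` and `hW` a component through `y`.
[provable (size M): PROVED in `Theorems/LangWeilTransferShatteringExclusionFewBranchesDescent.lean`;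
Stacks 04KZ (Galois action on irreducible components)] -/
def FewBranchesDescent : Prop :=
  ∀ (m B B' : ℕ) (I : Ideal (MvPolynomial (Fin m) ℚ)) (y : Fin m → ℂ) (K : IntermediateField ℚ ℂ),
    FiniteDimensional ℚ K → Module.finrank ℚ K ≤ B → (∀ v, y v ∈ K) →
      0 < {𝔓 : Ideal (MvPolynomial (Fin m) ℂ) |
            𝔓 ∈ (I.map (MvPolynomial.map (algebraMap ℚ ℂ))).minimalPrimes ∧
              𝔓 ≤ RingHom.ker (MvPolynomial.aeval y : MvPolynomial (Fin m) ℂ →ₐ[ℂ] ℂ)}.ncard →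
      {𝔓 : Ideal (MvPolynomial (Fin m) ℂ) |
            𝔓 ∈ (I.map (MvPolynomial.map (algebraMap ℚ ℂ))).minimalPrimes ∧
              𝔓 ≤ RingHom.ker (MvPolynomial.aeval y : MvPolynomial (Fin m) ℂ →ₐ[ℂ] ℂ)}.ncard ≤ B' →
        ∃ 𝔭 ∈ I.minimalPrimes,
          0 < ((Ideal.map (MvPolynomial.map (algebraMap ℚ (AlgebraicClosure ℚ))) 𝔭).minimalPrimes).ncard ∧
            ((Ideal.map (MvPolynomial.map (algebraMap ℚ (AlgebraicClosure ℚ))) 𝔭).minimalPrimes).ncard ≤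
              B * B'

/-- Stub LowDegreeConstants (registered obligation; signature = `LowDegreeConstants` verbatim,
byte-identical to v1). [open-problem grade: Burgisser2000 Ch. 4, Burgisser2000TCS,
doi:10.1006/jcom.1997.0433, arXiv:math/0301111; calibrated ⇔ RationalDescent (p579243/p581343)] -/
theorem stub_lowDegreeConstants :
    ∀ c : ℕ, ∃ c' d₀ N : ℕ, ∀ n ≥ N,
      (∃ P : Literature.Computability.AlgebraicComplexity.ArithCircuit ℂ (Fin n × Fin n),
          P.IsFanInTwo ∧ P.size ≤ n ^ c ∧
            P.Computes (Literature.Computability.AlgebraicComplexity.perPoly (Fin n) ℂ)) →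
        ∃ P : Literature.Computability.AlgebraicComplexity.ArithCircuit ℂ (Fin n × Fin n),
          P.IsFanInTwo ∧ P.size ≤ n ^ c' ∧
            P.Computes (Literature.Computability.AlgebraicComplexity.perPoly (Fin n) ℂ) ∧
            ∃ K : IntermediateField ℚ ℂ, FiniteDimensional ℚ K ∧ Module.finrank ℚ K ≤ n ^ d₀ ∧
              ∀ v : Fin (4 * P.size + 1),
                Literature.Computability.AlgebraicComplexity.slotConst P v ∈ K := by
  sorry

/-- Stub FewBranches (registered obligation; signature = `FewBranches` verbatim).
[conjecture grade: Burgisser2000TCS §5 (A3), arXiv:2606.25121, doi:10.1006/jcom.1997.0433] -/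
theorem stub_fewBranches :
    ∀ c d₀ : ℕ, ∃ c' d₀' d₁ N : ℕ, ∀ n ≥ N,
      (∃ P : Literature.Computability.AlgebraicComplexity.ArithCircuit ℂ (Fin n × Fin n),
          P.IsFanInTwo ∧ P.size ≤ n ^ c ∧
            P.Computes (Literature.Computability.AlgebraicComplexity.perPoly (Fin n) ℂ) ∧
            ∃ K : IntermediateField ℚ ℂ, FiniteDimensional ℚ K ∧ Module.finrank ℚ K ≤ n ^ d₀ ∧
              ∀ v : Fin (4 * P.size + 1),
                Literature.Computability.AlgebraicComplexity.slotConst P v ∈ K) →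
        ∃ P : Literature.Computability.AlgebraicComplexity.ArithCircuit ℂ (Fin n × Fin n),
          P.IsFanInTwo ∧ P.size ≤ n ^ c' ∧
            P.Computes (Literature.Computability.AlgebraicComplexity.perPoly (Fin n) ℂ) ∧
            ∃ K : IntermediateField ℚ ℂ, FiniteDimensional ℚ K ∧ Module.finrank ℚ K ≤ n ^ d₀' ∧
              (∀ v : Fin (4 * P.size + 1),
                Literature.Computability.AlgebraicComplexity.slotConst P v ∈ K) ∧
              ∃ I : Ideal (MvPolynomial (Fin (4 * P.size + 1)) ℚ),
                I = Ideal.span (Set.range fun α : (Fin n × Fin n) →₀ ℕ =>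
                  MvPolynomial.map (Int.castRingHom ℚ) (MvPolynomial.coeff α
                    (MvPolynomial.sumAlgEquiv ℤ (Fin n × Fin n) (Fin (4 * P.size + 1))
                      (Literature.Computability.AlgebraicComplexity.skeleton P).eval) -
                    MvPolynomial.C (MvPolynomial.coeff α
                      (Literature.Computability.AlgebraicComplexity.perPoly (Fin n) ℤ)))) ∧
                0 < {𝔓 : Ideal (MvPolynomial (Fin (4 * P.size + 1)) ℂ) |
                      𝔓 ∈ (I.map (MvPolynomial.map (algebraMap ℚ ℂ))).minimalPrimes ∧
                        𝔓 ≤ RingHom.ker (MvPolynomial.aeval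
                          (fun v : Fin (4 * P.size + 1) =>
                            Literature.Computability.AlgebraicComplexity.slotConst P v) :
                              MvPolynomial (Fin (4 * P.size + 1)) ℂ →ₐ[ℂ] ℂ)}.ncard ∧
                {𝔓 : Ideal (MvPolynomial (Fin (4 * P.size + 1)) ℂ) |
                    𝔓 ∈ (I.map (MvPolynomial.map (algebraMap ℚ ℂ))).minimalPrimes ∧
                      𝔓 ≤ RingHom.ker (MvPolynomial.aeval
                        (fun v : Fin (4 * P.size + 1) =>
                          Literature.Computability.AlgebraicComplexity.slotConst P v) :
                            MvPolynomial (Fin (4 * P.size + 1)) ℂ →ₐ[ℂ] ℂ)}.ncard ≤ n ^ d₁ := by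
  sorry

/-- Stub FewBranchesDescent (registered obligation; signature = `FewBranchesDescent` verbatim) —
**LANDED** p588469 (2026-08-28): discharged BY NAME by
`Summit.ValiantsHypothesis.ValiantsHypothesis.Theorems.LangWeilTransfer.ShatteringExclusion.stub_fewBranchesDescent`
(`Theorems/LangWeilTransferShatteringExclusionFewBranchesDescent.lean`). [cite: StacksProject, Tag 04KZ] -/
theorem stub_fewBranchesDescent :
    ∀ (m B B' : ℕ) (I : Ideal (MvPolynomial (Fin m) ℚ)) (y : Fin m → ℂ) (K : IntermediateField ℚ ℂ),
      FiniteDimensional ℚ K → Module.finrank ℚ K ≤ B → (∀ v, y v ∈ K) →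
        0 < {𝔓 : Ideal (MvPolynomial (Fin m) ℂ) |
              𝔓 ∈ (I.map (MvPolynomial.map (algebraMap ℚ ℂ))).minimalPrimes ∧
                𝔓 ≤ RingHom.ker (MvPolynomial.aeval y : MvPolynomial (Fin m) ℂ →ₐ[ℂ] ℂ)}.ncard →
        {𝔓 : Ideal (MvPolynomial (Fin m) ℂ) |
              𝔓 ∈ (I.map (MvPolynomial.map (algebraMap ℚ ℂ))).minimalPrimes ∧
                𝔓 ≤ RingHom.ker (MvPolynomial.aeval y : MvPolynomial (Fin m) ℂ →ₐ[ℂ] ℂ)}.ncard ≤ B' →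
          ∃ 𝔭 ∈ I.minimalPrimes,
            0 < ((Ideal.map (MvPolynomial.map (algebraMap ℚ (AlgebraicClosure ℚ))) 𝔭).minimalPrimes).ncard ∧
              ((Ideal.map (MvPolynomial.map (algebraMap ℚ (AlgebraicClosure ℚ))) 𝔭).minimalPrimes).ncard ≤
                B * B' :=
  Summit.ValiantsHypothesis.ValiantsHypothesis.Theorems.LangWeilTransfer.ShatteringExclusion.stub_fewBranchesDescent

/-! ## Name-keyed aliases of the stub statements (hypotheses of the composition)

`Registered.stub_X` is the statement of `stub_X` under the registered stub's short name, so that the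
native skeleton audit (`#h21_check_skeleton`: hypotheses admissible iff registered obligations /
declared stubs BY NAME) accepts `ShatteringExclusion_of : Registered.stub_… → … → ShatteringExclusion`
(device of v1 and of `Cruxes/RestorationQP/Lines/birth.lean`). -/
namespace Registered

/-- Alias of `LowDegreeConstants` (= the signature of `stub_lowDegreeConstants`). -/
abbrev stub_lowDegreeConstants : Prop := LowDegreeConstants
/-- Alias of `FewBranches` (= the signature of `stub_fewBranches`). -/
abbrev stub_fewBranches : Prop := FewBranches
/-- Alias of `FewBranchesDescent` (= the signature of `stub_fewBranchesDescent`). -/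
abbrev stub_fewBranchesDescent : Prop := FewBranchesDescent

end Registered

/-- **Composition** (the glue of the line, kernel-checked): constant descent (LowDegreeConstants)
puts the constants of a near-optimal circuit for `per_n` in a field of degree `≤ n^d₁`, FewBranches
moves the constant vector onto at most `n^{d₃}` components of the complexified constants variety
(degree `≤ n^d₂`), and Galois descent (FewBranchesDescent, LANDED p588469 and used by name) turns
that point certificate into a minimal prime of the coefficient ideal with `≤ n^d₂ · n^d₃ = n^(d₂+d₃)`
geometric components — the conclusion of SE with `c' = c₂`, `d₀ = d₂ + d₃`, `N = max N₁ N₂`.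
[folklore] -/
theorem ShatteringExclusion_of :
    Registered.stub_lowDegreeConstants → Registered.stub_fewBranches → ShatteringExclusion := by
  intro hA hB c
  have hC : Registered.stub_fewBranchesDescent := stub_fewBranchesDescent
  obtain ⟨c₁, d₁, N₁, hA'⟩ := hA c
  obtain ⟨c₂, d₂, d₃, N₂, hB'⟩ := hB c₁ d₁
  refine ⟨c₂, d₂ + d₃, max N₁ N₂, fun n hn hP => ?_⟩
  obtain ⟨P, hP2, hPs, hPc, K, hKfd, hKrk, hKmem, I, hI, hpos, hle⟩ :=
    hB' n (le_trans (le_max_right N₁ N₂) hn) (hA' n (le_trans (le_max_left N₁ N₂) hn) hP)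
  obtain ⟨𝔭, h𝔭, hpos', hle'⟩ :=
    hC (4 * P.size + 1) (n ^ d₂) (n ^ d₃) I
      (fun v : Fin (4 * P.size + 1) => Literature.Computability.AlgebraicComplexity.slotConst P v)
      K hKfd hKrk hKmem hpos hle
  exact ⟨P, hP2, hPs, hPc, I, hI, 𝔭, h𝔭, hpos', by rw [pow_add]; exact hle'⟩

/-- Wiring check: the registered stubs feed `ShatteringExclusion_of` exactly as stated, so the
skeleton is `ShatteringExclusion` closed modulo the stubs (sorries enter only through them). -/
example : ShatteringExclusion :=
  ShatteringExclusion_of stub_lowDegreeConstants stub_fewBranches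

/-! ## The v1 bet is a sufficient condition for the v2 bet -/

/-- **Unibranching** (v1's structural stub, now UNREGISTERED and kept as a sufficient condition):
as `FewBranches` but with EXACTLY ONE minimal prime of `I·ℂ[Y]` below the point ideal
(`∃!`). Sufficient conditions recorded by val-width-6372-p1 g0: primality of the local radical
`√(I·ℂ[Y]_{𝔪_y})` (`…UnibranchLocal.existsUnique_minimalPrimes_le_ker_iff`), e.g. a smooth point.
[conjecture grade; Burgisser2000TCS §5 (A3)] -/
def Unibranching : Prop :=
  ∀ c d₀ : ℕ, ∃ c' d₀' N : ℕ, ∀ n ≥ N,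
    (∃ P : Literature.Computability.AlgebraicComplexity.ArithCircuit ℂ (Fin n × Fin n),
        P.IsFanInTwo ∧ P.size ≤ n ^ c ∧
          P.Computes (Literature.Computability.AlgebraicComplexity.perPoly (Fin n) ℂ) ∧
          ∃ K : IntermediateField ℚ ℂ, FiniteDimensional ℚ K ∧ Module.finrank ℚ K ≤ n ^ d₀ ∧
            ∀ v : Fin (4 * P.size + 1),
              Literature.Computability.AlgebraicComplexity.slotConst P v ∈ K) →
      ∃ P : Literature.Computability.AlgebraicComplexity.ArithCircuit ℂ (Fin n × Fin n),
        P.IsFanInTwo ∧ P.size ≤ n ^ c' ∧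
          P.Computes (Literature.Computability.AlgebraicComplexity.perPoly (Fin n) ℂ) ∧
          ∃ K : IntermediateField ℚ ℂ, FiniteDimensional ℚ K ∧ Module.finrank ℚ K ≤ n ^ d₀' ∧
            (∀ v : Fin (4 * P.size + 1),
              Literature.Computability.AlgebraicComplexity.slotConst P v ∈ K) ∧
            ∃! 𝔓 : Ideal (MvPolynomial (Fin (4 * P.size + 1)) ℂ),
              𝔓 ∈ ((Ideal.span (Set.range fun α : (Fin n × Fin n) →₀ ℕ =>
                MvPolynomial.map (Int.castRingHom ℚ) (MvPolynomial.coeff α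
                  (MvPolynomial.sumAlgEquiv ℤ (Fin n × Fin n) (Fin (4 * P.size + 1))
                    (Literature.Computability.AlgebraicComplexity.skeleton P).eval) -
                  MvPolynomial.C (MvPolynomial.coeff α
                    (Literature.Computability.AlgebraicComplexity.perPoly (Fin n) ℤ))))).map
                (MvPolynomial.map (algebraMap ℚ ℂ))).minimalPrimes ∧
              𝔓 ≤ RingHom.ker (MvPolynomial.aeval
                (fun v : Fin (4 * P.size + 1) =>
                  Literature.Computability.AlgebraicComplexity.slotConst P v) :
                    MvPolynomial (Fin (4 * P.size + 1)) ℂ →ₐ[ℂ] ℂ)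

/-- **v1 ⇒ v2**: a constant vector on exactly one component lies on at most `n^0 = 1` components
(`d₁ = 0`; the set of minimal primes below the point ideal is a singleton). [folklore] -/
theorem fewBranches_of_unibranching : Unibranching → FewBranches := by
  intro h c d₀
  obtain ⟨c', d₀', N, hN⟩ := h c d₀
  refine ⟨c', d₀', 0, N, fun n hn hex => ?_⟩
  obtain ⟨P, hP2, hPs, hPc, K, hKfd, hKdeg, hmem, huniq⟩ := hN n hn hex
  refine ⟨P, hP2, hPs, hPc, K, hKfd, hKdeg, hmem, _, rfl, ?_⟩
  obtain ⟨𝔓, h𝔓, h𝔓uniq⟩ := huniq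
  have hS : {𝔔 : Ideal (MvPolynomial (Fin (4 * P.size + 1)) ℂ) |
      𝔔 ∈ ((Ideal.span (Set.range fun α : (Fin n × Fin n) →₀ ℕ =>
        MvPolynomial.map (Int.castRingHom ℚ) (MvPolynomial.coeff α
          (MvPolynomial.sumAlgEquiv ℤ (Fin n × Fin n) (Fin (4 * P.size + 1))
            (Literature.Computability.AlgebraicComplexity.skeleton P).eval) -
          MvPolynomial.C (MvPolynomial.coeff α
            (Literature.Computability.AlgebraicComplexity.perPoly (Fin n) ℤ))))).map
        (MvPolynomial.map (algebraMap ℚ ℂ))).minimalPrimes ∧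
      𝔔 ≤ RingHom.ker (MvPolynomial.aeval
        (fun v : Fin (4 * P.size + 1) =>
          Literature.Computability.AlgebraicComplexity.slotConst P v) :
            MvPolynomial (Fin (4 * P.size + 1)) ℂ →ₐ[ℂ] ℂ)} = {𝔓} :=
    Set.eq_singleton_iff_unique_mem.2 ⟨h𝔓, fun 𝔔 h𝔔 => h𝔓uniq 𝔔 h𝔔⟩
  rw [hS, Set.ncard_singleton, pow_zero]
  exact ⟨Nat.one_pos, le_rfl⟩

end Summit.ValiantsHypothesis.ValiantsHypothesis.Cruxes.ShatteringExclusion.Birth
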